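import Mathlib
import HarnessLib
import Literature.Geometry.Lorentzian.KerrConvergence
import Literature.Geometry.Lorentzian.QuasiFinalStateDecomposition
import Literature.Geometry.Lorentzian.CausalFutureCompactSet
import Summits.FinalStateConjecture.FinalStateConjecture.Statement
import Summits.FinalStateConjecture.FinalStateConjecture.Theorems.LogTimeThreeAnnuliDyadicCaptureDefs

/-!
# Route LogTimeThreeAnnuli · crux `DyadicCapture` — stub 6a: the late restricted images lie in `O''`

Helper for stub 6a (`stub_horizonNormalisedRestriction`) of the line `registered` of the crux
`Summit.FinalStateConjecture.FinalStateConjecture.Theses.LogTimeThreeAnnuli.DyadicCapture`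
(stmt-FinalStateConjecture-17488). Stub 6a asks, for an honest era system `d, R` with frozen
members `(Mᵢ, aᵢ)`, for a chart time `τ₁ ≥ τ₀` after which (among five causal clauses) the late images
of the RESTRICTED system — the reference hole charts cut down to the frozen exteriors
`{r_{aᵢ} > r₊(Mᵢ, aᵢ)}` (`restrictedRegion`), and the flat chart's image of `{x⁰ > τ₁}` — lie in the
self-determined exterior `O'' = exteriorOf 𝒟 (restrictedCharted … τ₁) = J⁺(ι X) ∩ I⁻(restricted charted
region)`. THESE two clauses hold for EVERY `τ₁ ≥ τ₀` and use only the first era clause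
`O = exteriorOf 𝒟 charted(d)` together with the late-chart axioms: the late images are OPEN (images of
open subsets of the late regions under the open embeddings `chart i|{t*ᵢ > τ₀}`, `flatChart|{x⁰ > τ₀}`),
they lie in `O ⊆ J⁺(ι X)`, and an open set lies in its own chronological past (through every point of
a time-oriented Lorentzian manifold without boundary passes a short future timelike curve staying in
any given neighbourhood, `LorentzianMetric.exists_mem_nhds_mem_chronologicalFuture` for the reversed
time orientation; O'Neill 1983, Ch. 14, p. 403). Main statement:
`horizonRestriction_lateImages_subset_exteriorOf`.

The remaining clauses of stub 6a (rays stay in `closure O''`, covering, exhaustion with radii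
dominated by `Rᵢ − |aᵢ| − |d.spin i|`) are NOT proved here; see the crux item's notes.
-/

-- the `Summit.FinalStateConjecture.FinalStateConjecture.…` namespace repeats the summit = sub-problem
-- segment (D-0017 layout, CONVENTIONS §2); the duplicate is deliberate.
set_option linter.dupNamespace false

noncomputable section

namespace Summit.FinalStateConjecture.FinalStateConjecture.Theorems

open Literature.Geometry.Lorentzian
open scoped Topology Manifold ENNReal ContDiff
open Filter Set

/-! ### Open sets lie in their own chronological past -/

section Development

variable {X : Type} [TopologicalSpace X] [ChartedSpace E3 X] [IsManifold (𝓡 3) ∞ X]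
  [ConnectedSpace X] {D : InitialDataSet (𝓡 3) X}

/-- **An open set lies in its own chronological past**: for an open `U` of the carrier of a Cauchy
development and `x ∈ U` there is `x' ∈ U` with `x ≪ x'` (a point slightly to the future of `x` on the
integral curve of the orienting field, `exists_mem_nhds_mem_chronologicalFuture` for the reversed time
orientation). O'Neill 1983, Ch. 14, p. 403 (points `p⁺ ≫ p` exist in every neighbourhood).
[cite: ONeill1983, Ch. 14  p. 403] -/
theorem horizonRestriction_subset_chronologicalPast_of_isOpen (𝒟 : CauchyDevelopment D)
    {U : Set 𝒟.carrier} (hU : IsOpen U) :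
    U ⊆ 𝒟.metric.chronologicalPast 𝒟.timeOrientation U := by
  intro x hx
  obtain ⟨x', hx'U, hxx'⟩ := LorentzianMetric.exists_mem_nhds_mem_chronologicalFuture
    (g := 𝒟.metric) (τ := 𝒟.timeOrientation.reverse) (by exact_mod_cast le_top) (hU.mem_nhds hx)
  exact LorentzianMetric.chronologicalFuture_mono (singleton_subset_iff.2 hx'U) hxx'

/-- **An open part of an exterior region lies in the exterior region of any charted set containing
it**: if `U` is open, `U ⊆ exteriorOf 𝒟 W` (so `U ⊆ J⁺(ι X)`) and `U ⊆ V`, then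
`U ⊆ exteriorOf 𝒟 V = J⁺(ι X) ∩ I⁻(V)`. [folklore] -/
theorem horizonRestriction_subset_exteriorOf_of_isOpen (𝒟 : CauchyDevelopment D)
    {U V W : Set 𝒟.carrier} (hU : IsOpen U)
    (hUW : U ⊆ Summit.FinalStateConjecture.exteriorOf 𝒟 W) (hUV : U ⊆ V) :
    U ⊆ Summit.FinalStateConjecture.exteriorOf 𝒟 V := fun _ hx ↦
  ⟨(hUW hx).1, LorentzianMetric.chronologicalFuture_mono hUV
    (horizonRestriction_subset_chronologicalPast_of_isOpen 𝒟 hU hx)⟩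

end Development

/-! ### The late restricted images are open and lie in `O` -/

section Spacetime

variable (𝓢 : Spacetime.{0} 4) (O : Set 𝓢.carrier) (d : QuasiFinalStateDecomposition 𝓢 O 2 ⊤)

/-- The image of an open subset of the late region `{t > τ₀}` under a late-time chart is open (the
chart restricted to the late region is an open embedding). DHRT arXiv:2104.08222, §1.
[cite: arXiv210408222, §1] -/
theorem horizonRestriction_isOpen_image_of_isLateChart {B : ModelBackground} {τ₀ : ℝ}
    {Ψ : B.domain → 𝓢.carrier} (hΨ : 𝓢.IsLateChart B O τ₀ Ψ) {S : Set B.domain} (hS : IsOpen S)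
    (hSl : S ⊆ B.lateRegion τ₀) : IsOpen (Ψ '' S) := by
  have h1 : (B.lateRegion τ₀).restrict Ψ '' (Subtype.val ⁻¹' S) = Ψ '' S := by
    rw [Set.restrict_eq, Set.image_comp, Subtype.image_preimage_val, inter_eq_right.2 hSl]
  rw [← h1]
  exact hΨ.isOpenEmbedding.isOpenMap _ (hS.preimage continuous_subtype_val)

/-- The restricted hole region after `τ₁ ≥ τ₀` is open: it is the image of the open set
`{τ₁ < t*ᵢ} ∩ {r_{aᵢ} > r₊(Mᵢ, aᵢ)}` of the late region under the reference hole chart.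
[cite: DafermosLuk2017, Conjecture 1 (b)] -/
theorem horizonRestriction_isOpen_restrictedRegion (M a : Fin d.N → ℝ) {τ₁ : ℝ} (hτ : d.τ₀ ≤ τ₁)
    (i : Fin d.N) : IsOpen (restrictedRegion 𝓢 O d M a τ₁ i) := by
  have hc0 : Continuous fun y : E4 ↦ y 0 := PiLp.continuous_apply 2 _ 0
  have htime : Continuous fun x : (d.background i).domain ↦ (d.background i).time x.1 := by
    change Continuous fun x : (d.background i).domain ↦
      poincareInv (d.motion i).1 (d.motion i).2 x.1 0
    exact (hc0.comp (continuous_poincareInv (d.motion i).1 (d.motion i).2)).comp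
      continuous_subtype_val
  have hpi : Continuous fun x : (d.background i).domain ↦
      poincareInv (d.motion i).1 (d.motion i).2 x.1 :=
    (continuous_poincareInv (d.motion i).1 (d.motion i).2).comp continuous_subtype_val
  have hS : IsOpen {x : (d.background i).domain | τ₁ < (d.background i).time x.1 ∧
      poincareInv (d.motion i).1 (d.motion i).2 x.1 ∈ Kerr.exterior (M i) (a i)} :=
    (isOpen_lt continuous_const htime).inter ((Kerr.exterior (M i) (a i)).isOpen.preimage hpi)
  exact horizonRestriction_isOpen_image_of_isLateChart 𝓢 O (d.isLateChart i) hS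
    fun x hx ↦ lt_of_le_of_lt hτ hx.1

/-- The flat chart's image of `{x⁰ > τ₁}`, `τ₁ ≥ τ₀`, is open. [cite: DafermosLuk2017, Conjecture 1 (b)] -/
theorem horizonRestriction_isOpen_image_flat_lateRegion {τ₁ : ℝ} (hτ : d.τ₀ ≤ τ₁) :
    IsOpen (d.flatChart '' (Minkowski.backgroundOn d.flatDomain).lateRegion τ₁) := by
  have hc0 : Continuous fun y : E4 ↦ y 0 := PiLp.continuous_apply 2 _ 0
  have htime : Continuous fun x : (Minkowski.backgroundOn d.flatDomain).domain ↦
      (Minkowski.backgroundOn d.flatDomain).time x.1 := by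
    change Continuous fun x : (Minkowski.backgroundOn d.flatDomain).domain ↦ (x.1 : E4) 0
    exact hc0.comp continuous_subtype_val
  exact horizonRestriction_isOpen_image_of_isLateChart 𝓢 O d.isLateChart_flat
    (isOpen_lt continuous_const htime) ((Minkowski.backgroundOn d.flatDomain).lateRegion_mono hτ)

/-- The restricted hole region after `τ₁ ≥ τ₀` lies in the reference black-hole region, hence in
`O`. [cite: DafermosLuk2017, Conjecture 1 (b)] -/
theorem horizonRestriction_restrictedRegion_subset (M a : Fin d.N → ℝ) {τ₁ : ℝ} (hτ : d.τ₀ ≤ τ₁)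
    (i : Fin d.N) : restrictedRegion 𝓢 O d M a τ₁ i ⊆ O :=
  (image_mono fun _ hx ↦ (ModelBackground.mem_lateRegion).2 (lt_of_le_of_lt hτ hx.1)).trans
    (d.isLateChart i).image_subset

/-- The flat chart's image of `{x⁰ > τ₁}`, `τ₁ ≥ τ₀`, lies in `O`. [cite: DafermosLuk2017, Conjecture 1 (b)] -/
theorem horizonRestriction_image_flat_lateRegion_subset {τ₁ : ℝ} (hτ : d.τ₀ ≤ τ₁) :
    d.flatChart '' (Minkowski.backgroundOn d.flatDomain).lateRegion τ₁ ⊆ O :=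
  (image_mono ((Minkowski.backgroundOn d.flatDomain).lateRegion_mono hτ)).trans
    d.isLateChart_flat.image_subset

end Spacetime

/-! ### The two image clauses of stub 6a, for every `τ₁ ≥ τ₀` -/

/-- **Late restricted images lie in `O''`** (clauses (iv)–(v) of stub 6a of the line `registered`,
for EVERY chart time `τ₁ ≥ τ₀`): for an honest era system `d, R` of a vacuum Cauchy development and
any parameters `(Mᵢ, aᵢ)`, every restricted hole region `restrictedRegion … τ₁ i` and the flat chart's
image of `{x⁰ > τ₁}` lie in `exteriorOf 𝒟 (restrictedCharted … τ₁) = J⁺(ι X) ∩ I⁻(restricted charted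
region)`. Only the clause `O = exteriorOf 𝒟 charted(d)` of the era is used: the late images are open
parts of `O ⊆ J⁺(ι X)` contained in the restricted charted region, and an open set lies in its own
chronological past (O'Neill 1983, Ch. 14, p. 403). [cite: DafermosLuk2017, Conjecture 1 (b)] -/
theorem horizonRestriction_lateImages_subset_exteriorOf : ∀ (X : Type) [TopologicalSpace X] [ChartedSpace E3 X] [IsManifold (𝓡 3) ((⊤ : ℕ∞) : WithTop ℕ∞) X] [T2Space X] [SecondCountableTopology X] [ConnectedSpace X] (D : InitialDataSet (𝓡 3) X) (𝒟 : VacuumCauchyDevelopment D) (O : Set 𝒟.carrier) (d : QuasiFinalStateDecomposition 𝒟.toSpacetime O 2 ⊤) (R : Fin d.N → ℝ → ℝ) (M a : Fin d.N → ℝ), Summit.FinalStateConjecture.FinalStateConjecture.Theorems.IsHonestEraSystem 𝒟 O d R → ∀ τ₁ : ℝ, d.τ₀ ≤ τ₁ → (∀ i : Fin d.N, Summit.FinalStateConjecture.FinalStateConjecture.Theorems.restrictedRegion 𝒟.toSpacetime O d M a τ₁ i ⊆ Summit.FinalStateConjecture.exteriorOf 𝒟.toCauchyDevelopment (Summit.FinalStateConjecture.FinalStateConjecture.Theorems.restrictedCharted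 𝒟.toSpacetime O d M a τ₁)) ∧ d.flatChart '' (Minkowski.backgroundOn d.flatDomain).lateRegion τ₁ ⊆ Summit.FinalStateConjecture.exteriorOf 𝒟.toCauchyDevelopment (Summit.FinalStateConjecture.FinalStateConjecture.Theorems.restrictedCharted 𝒟.toSpacetime O d M a τ₁) := by
  intro X _ _ _ _ _ _ D 𝒟 O d R M a hera τ₁ hτ
  have hO : O = Summit.FinalStateConjecture.exteriorOf 𝒟.toCauchyDevelopment d.charted := hera.1
  refine ⟨fun i ↦ ?_, ?_⟩
  · refine horizonRestriction_subset_exteriorOf_of_isOpen 𝒟.toCauchyDevelopment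
      (W := d.charted) (horizonRestriction_isOpen_restrictedRegion 𝒟.toSpacetime O d M a hτ i)
      (hO ▸ horizonRestriction_restrictedRegion_subset 𝒟.toSpacetime O d M a hτ i) ?_
    exact (subset_iUnion (fun j ↦ restrictedRegion 𝒟.toSpacetime O d M a τ₁ j) i).trans
      subset_union_right
  · exact horizonRestriction_subset_exteriorOf_of_isOpen 𝒟.toCauchyDevelopment (W := d.charted)
      (horizonRestriction_isOpen_image_flat_lateRegion 𝒟.toSpacetime O d hτ)
      (hO ▸ horizonRestriction_image_flat_lateRegion_subset 𝒟.toSpacetime O d hτ)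
      subset_union_left

end Summit.FinalStateConjecture.FinalStateConjecture.Theorems

end
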